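import Mathlib.Analysis.Real.Pi.Bounds
import Mathlib.Tactic.IntervalCases
import Mathlib.Tactic.NormNum.Prime
import Literature.NumberTheory.LFunctions.ChainCheck
import Literature.NumberTheory.LFunctions.ChainTableSieve
import HarnessLib

/-!
# Schoenfeld's `θ`-bound on a finite range by kernel computation: the checker
# (plan N2 of provefact `Literature.NumberTheory.LFunctions.robin_iff`)

Topic: `Literature/NumberTheory/LFunctions`. The named fact `Schoenfeld1976_theta`
(`NicolasMertensRH.lean`; L. Schoenfeld, Math. Comp. 30 (1976), Thm. 10, (6.3): under RH,
`|θ(x) − x| ≤ √x log² x/(8π)` for `x ≥ 599`) is, on any *finite* range `599 ≤ x ≤ X₀`, a finite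
statement about the primes `≤ X₀` that holds unconditionally; Schoenfeld himself settles
`599 ≤ x ≤ e¹⁶` by the tables of Rosser–Walker, Rosser–Schoenfeld 1962 (Thms. 18–19) and Gram
(proof of Thm. 10, p. 339), his analytic argument (Rosser–Schoenfeld 1975, Lemmas 8–9) taking over
at `e¹⁶`. This file is the *computable core* of a kernel certificate for such a range, walking the
table of primes `ChainTable.table` (the `322441` primes below `4.6·10⁶`, complete:
`ChainTableFacts.tableOK`) — the analogue for `θ` of the colossally abundant chain checker
`ChainCheck.lean`; the semantic soundness is `ThetaChainSound.lean`, the run `ThetaChainRun*.lean`,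
the assembly `ThetaSmallRange.lean`.

## The state and one step

A state `⟨p, Llo, Lhi, Tlo, Thi⟩` records the last prime `p` reached together with natural-number
enclosures `Llo ≤ 2⁸⁰ log p ≤ Lhi` and `Tlo ≤ 2⁸⁰ θ(p) ≤ Thi`. A step to the next table entry `p'`
(`step`) checks that `p < p'`, that `p'` is odd and **prime** (`primeChk`: for `p' ≤ 2143` by trial
division over the odd primes `≤ 2143`, `ChainTable.hasFactor`; beyond, by *one* `gcd` with their
product `ChainTable.sieveModulus` — an odd `n < 2153²` coprime to it is prime), extends the
enclosures (`logNext`: `log p' = log p + log(1 + (p'−p)/p)` by the short alternating series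
`ChainCheck.lnp` when `2(p'−p) ≤ p`, else the full logarithm `ChainCheck.logN`), and performs the two
comparisons that give `|θ(x) − x| ≤ √x log² x/(8π)` on `[p, p')` once `p ≥ 599`
(`ThetaChainSound`): at the right end, `2⁸⁰ p' − Tlo(p) ≤ 2⁸⁰ B(p)`, and at the new prime,
`Thi(p') − 2⁸⁰ p' ≤ 2⁸⁰ B(p')`, where `B(p) = √p log² p/(8π)` is bounded below through
`log p ≥ Llo/2⁸⁰` and compared **after squaring** (`chkB`: `D²·2¹⁶⁰·64π² ≤ p·Llo⁴`, with
`64π² < 631.654821`, so that no square root is evaluated). `run` iterates over a segment of the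
table with fuel (chunks of `20000` entries; `runD` restarts from the table cursor after `p`), from
`initS = ⟨2, log 2, log 2⟩` (`ChainCheck.L2LON ≤ 2⁸⁰ log 2 ≤ ChainCheck.L2HIN`).

All arithmetic is on `ℕ` with the kernel's GMP-accelerated primitives (`Nat.add`, `Nat.mul`,
`Nat.pow`, `Nat.gcd`, `Nat.ble`, …), as in `ChainCheck.lean`; measured kernel cost `≈ 1.5 ms` per
prime. **Proved here** (Part 1): `chkB_sound`, `hasFactor_false_sound`, `primeChk_sound` (with the
kernel facts `smallOddPrimes_walk`, `smallOddPrimes_sorted` certifying that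
`ChainTable.smallOddPrimes` is exactly the increasing list of odd primes `≤ 2143`),
`logNext_sound`. Nothing is asserted: the `def`s are the computable functions and one constant.

## References

* L. Schoenfeld, *Sharper bounds for the Chebyshev functions θ(x) and ψ(x). II*, Math. Comp. 30
  (1976), 337–360, Thm. 10 (6.3) and its proof, p. 339 (the range below `e¹⁶` by tables).
  [Schoenfeld1976]
* J. B. Rosser, L. Schoenfeld, *Approximate formulas for some functions of prime numbers*,
  Illinois J. Math. 6 (1962), 64–94, Thms. 18–19 (the tables used by Schoenfeld).
  [RosserSchoenfeld1962]
-/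

namespace Literature.NumberTheory.LFunctions.ThetaChain

open ChainCheck ChainTable

/-! ### The comparison with `B(p) = √p log² p/(8π)`, squared -/

/-- `2¹⁶⁰` as a numeral. [folklore] -/
def P160 : ℕ := 1461501637330902918203684832716283019655932542976

/-- `chkB D p Llo`: the test `D²·2¹⁶⁰·6316548210 ≤ p·Llo⁴·10⁷`; since `64π² < 631.654821`, it
implies `D ≤ 2⁸⁰ √p (Llo/2⁸⁰)²/(8π)` (`chkB_sound`). [folklore] -/
def chkB (D p Llo : ℕ) : Bool :=
  Nat.ble (Nat.mul (Nat.mul (Nat.mul D D) P160) 6316548210)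
    (Nat.mul (Nat.mul p (Nat.pow Llo 4)) 10000000)

/-! ### Primality of a table entry -/

/-- Primality certificate for an odd `n < 2153²`: trial division by the odd primes `≤ 2143` if
`n ≤ 2143` (`ChainTable.hasFactor` finds no factor, and `n > 1`), otherwise
`gcd(n, ∏_{3 ≤ q ≤ 2143} q) = 1` (`ChainTable.sieveModulus`). [folklore] -/
def primeChk (n : ℕ) : Bool :=
  bif Nat.ble n 2143 then Nat.blt 1 n && !(hasFactor smallOddPrimes n)
  else Nat.beq (Nat.gcd n sieveModulus) 1

/-! ### States, the logarithm of the next prime, one step, the run -/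

/-- A state of the `θ`-chain: the prime `p` reached, `Llo ≤ 2⁸⁰ log p ≤ Lhi`,
`Tlo ≤ 2⁸⁰ θ(p) ≤ Thi`. [folklore] -/
structure TS where
  /-- the last prime reached -/
  p : ℕ
  /-- lower bound of `2⁸⁰ log p` -/
  Llo : ℕ
  /-- upper bound of `2⁸⁰ log p` -/
  Lhi : ℕ
  /-- lower bound of `2⁸⁰ θ(p)` -/
  Tlo : ℕ
  /-- upper bound of `2⁸⁰ θ(p)` -/
  Thi : ℕ
  deriving Repr, DecidableEq

/-- Enclosure of `2⁸⁰ log p'` from that of `2⁸⁰ log p` (`p ≤ p'`): by `log p' = log p + log(1 + g/p)`,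
`g = p' − p`, with `ChainCheck.lnp` when `2g ≤ p`, else directly by `ChainCheck.logN`. [folklore] -/
def logNext (p Llo Lhi p' : ℕ) : Option (ℕ × ℕ) :=
  let g := Nat.sub p' p
  bif Nat.ble (Nat.mul 2 g) p then
    match lnp g p with
    | (dlo, dhi) => some (Nat.add Llo dlo, Nat.add Lhi dhi)
  else logN p'

/-- **One step** of the `θ`-chain, to the next table entry `p'`: order, parity and primality of `p'`;
the right-end check of `[p, p')` (if `p ≥ 599`); the new enclosures; the check at `p'`
(if `p' ≥ 599`). [folklore] -/
def step (s : TS) (p' : ℕ) : Option TS :=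
  match s with
  | ⟨p, Llo, Lhi, Tlo, Thi⟩ =>
    bif !(Nat.blt p p' && Nat.beq (Nat.mod p' 2) 1 && primeChk p') then none else
    bif !(Nat.blt p 599 || chkB (Nat.sub (Nat.mul SC p') Tlo) p Llo) then none else
    match logNext p Llo Lhi p' with
    | none => none
    | some (Llo', Lhi') =>
      let Tlo' := Nat.add Tlo Llo'
      let Thi' := Nat.add Thi Lhi'
      bif !(Nat.blt p' 599 || chkB (Nat.sub Thi' (Nat.mul SC p')) p' Llo') then none
      else some ⟨p', Llo', Lhi', Tlo', Thi'⟩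

/-- Run over a segment of the table with fuel (a chunk): stops successfully when the fuel or the
segment is exhausted, fails as soon as a step fails. [folklore] -/
def run : ℕ → TS → List ℕ → Option TS
  | 0, s, _ => some s
  | _ + 1, s, [] => some s
  | fuel + 1, s, p' :: rest =>
    match step s p' with
    | none => none
    | some s' => run fuel s' rest

/-- The initial state: `p = 2`, `θ(2) = log 2` (`L2LON ≤ 2⁸⁰ log 2 ≤ L2HIN`). [folklore] -/
def initS : TS := ⟨2, L2LON, L2HIN, L2LON, L2HIN⟩

/-- **A chunk of the run**: at most `fuel` entries of `ChainTable.table` after the state's prime.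
[folklore] -/
def runD (fuel : ℕ) (s : TS) : Option TS := run fuel s (ChainCheck.after s.p table)

/-! ## Soundness, part 1: the arithmetic and primality primitives -/

section Sound

/-- `P160 = 2¹⁶⁰`. [folklore] -/
theorem P160_eq : P160 = 2 ^ 160 := by norm_num [P160]

/-- `64π² · 10⁷ ≤ 6316548210` (from `π < 3.141593`). [folklore] -/
theorem pi_sq_bound : 64 * Real.pi ^ 2 * 10000000 ≤ 6316548210 := by
  have h := Real.pi_lt_d6
  have h0 := Real.pi_pos
  nlinarith

/-- **Soundness of `chkB`**: if `chkB D p Llo` holds and `0 ≤ Llo ≤ 2⁸⁰ log p`, then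
`D ≤ 2⁸⁰ · (√p log² p/(8π))`. [folklore] -/
theorem chkB_sound {D p Llo : ℕ} (h : chkB D p Llo = true) (hp : 1 ≤ p)
    (hL : (Llo : ℝ) ≤ 2 ^ 80 * Real.log p) :
    (D : ℝ) ≤ 2 ^ 80 * (Real.sqrt p * Real.log p ^ 2 / (8 * Real.pi)) := by
  have hπ := Real.pi_pos
  have hble : D * D * P160 * 6316548210 ≤ p * Llo ^ 4 * 10000000 := by
    simpa [chkB, Nat.ble_eq, Nat.mul_eq, Nat.pow_eq] using h
  have hR : (D : ℝ) * D * 2 ^ 160 * 6316548210 ≤ (p : ℝ) * (Llo : ℝ) ^ 4 * 10000000 := by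
    rw [P160_eq] at hble
    exact_mod_cast hble
  have hpR : (1 : ℝ) ≤ p := by exact_mod_cast hp
  have hlog0 : 0 ≤ Real.log p := Real.log_nonneg hpR
  have hLlo0 : (0 : ℝ) ≤ Llo := Nat.cast_nonneg _
  -- `(D · 2⁸⁰ · 8π)² ≤ p · Llo⁴ ≤ p · (2⁸⁰ log p)⁴`
  have h1 : ((D : ℝ) * 2 ^ 80 * (8 * Real.pi)) ^ 2 ≤ (p : ℝ) * (Llo : ℝ) ^ 4 := by
    have e : ((D : ℝ) * 2 ^ 80 * (8 * Real.pi)) ^ 2 =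
        (D : ℝ) * D * 2 ^ 160 * (64 * Real.pi ^ 2 * 10000000) / 10000000 := by ring
    rw [e, div_le_iff₀ (by norm_num)]
    calc (D : ℝ) * D * 2 ^ 160 * (64 * Real.pi ^ 2 * 10000000)
        ≤ (D : ℝ) * D * 2 ^ 160 * 6316548210 := by
          apply mul_le_mul_of_nonneg_left pi_sq_bound; positivity
      _ ≤ (p : ℝ) * (Llo : ℝ) ^ 4 * 10000000 := hR
  have h2 : (p : ℝ) * (Llo : ℝ) ^ 4 ≤ (p : ℝ) * (2 ^ 80 * Real.log p) ^ 4 := by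
    apply mul_le_mul_of_nonneg_left _ (by positivity)
    exact pow_le_pow_left₀ hLlo0 hL 4
  have e2 : (Real.sqrt p * (2 ^ 80 * Real.log p) ^ 2) ^ 2 = (p : ℝ) * (2 ^ 80 * Real.log p) ^ 4 := by
    rw [mul_pow, Real.sq_sqrt (by positivity), ← pow_mul]
  have h3 : ((D : ℝ) * 2 ^ 80 * (8 * Real.pi)) ^ 2 ≤
      (Real.sqrt p * (2 ^ 80 * Real.log p) ^ 2) ^ 2 := by
    rw [e2]
    exact h1.trans h2
  have h4 : (D : ℝ) * 2 ^ 80 * (8 * Real.pi) ≤ Real.sqrt p * (2 ^ 80 * Real.log p) ^ 2 :=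
    (pow_le_pow_iff_left₀ (by positivity) (by positivity) two_ne_zero).1 h3
  have h5 : (D : ℝ) ≤ Real.sqrt p * (2 ^ 80 * Real.log p) ^ 2 / (2 ^ 80 * (8 * Real.pi)) := by
    rw [le_div_iff₀ (by positivity)]
    linarith [h4]
  calc (D : ℝ) ≤ Real.sqrt p * (2 ^ 80 * Real.log p) ^ 2 / (2 ^ 80 * (8 * Real.pi)) := h5
    _ = 2 ^ 80 * (Real.sqrt p * Real.log p ^ 2 / (8 * Real.pi)) := by
        field_simp

/-! ### `smallOddPrimes` is the increasing list of the odd primes `≤ 2143` -/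

/-- Kernel fact: the trial-division walk of `ChainTable.lean` succeeds on `smallOddPrimes` itself
(from `3`), certifying that it is strictly increasing, with odd entries, and contains every odd
prime up to its last entry `2143`. [folklore] -/
theorem smallOddPrimes_walk : walk smallOddPrimes 1100 3 smallOddPrimes = true := by
  decide +kernel

/-- `2143 ∈ smallOddPrimes` (its last entry). [folklore] -/
theorem mem_smallOddPrimes_2143 : 2143 ∈ smallOddPrimes := by decide +kernel

/-- `smallOddPrimes` is strictly increasing, its entries are odd and `≥ 3`, and every odd prime
`≤ 2143` is an entry. [folklore] -/
theorem smallOddPrimes_spec :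
    smallOddPrimes.Pairwise (· < ·) ∧ (∀ p ∈ smallOddPrimes, 3 ≤ p ∧ Odd p) ∧
      ∀ n : ℕ, n.Prime → Odd n → n ≤ 2143 → n ∈ smallOddPrimes := by
  obtain ⟨h1, h2, h3⟩ := walk_sound two_le_of_mem_smallOddPrimes 1100 3 smallOddPrimes
    smallOddPrimes_walk ⟨1, rfl⟩
  refine ⟨h1, h2, fun n hn hodd hle => h3 n hn hodd ?_ ⟨2143, mem_smallOddPrimes_2143, hle⟩⟩
  obtain ⟨k, hk⟩ := hodd
  have := hn.two_le
  omega

/-- **Soundness of a failed trial division** over an increasing list: if `hasFactor ps n = false`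
then no entry `q` with `q² ≤ n` divides `n`. [folklore] -/
theorem hasFactor_false_sound : ∀ (ps : List ℕ) (n : ℕ), ps.Pairwise (· < ·) →
    hasFactor ps n = false → ∀ q ∈ ps, q * q ≤ n → ¬ q ∣ n
  | [], _, _, _, q, hq, _ => by simp at hq
  | q :: t, n, hs, h, q', hq', hqq => by
      simp only [hasFactor, Nat.mul_eq] at h
      rw [List.pairwise_cons] at hs
      cases hb : Nat.blt n (q * q) with
      | true =>
        -- `n < q²`: no entry of `q :: t` has its square `≤ n`
        exfalso
        have hlt : n < q * q := by simpa [Nat.blt_eq] using hb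
        have hle : q ≤ q' := by
          rcases List.mem_cons.1 hq' with rfl | hq'
          · exact le_rfl
          · exact (hs.1 q' hq').le
        have := Nat.mul_le_mul hle hle
        omega
      | false =>
        rw [hb] at h
        simp only [cond_false] at h
        cases hm : Nat.beq (Nat.mod n q) 0 with
        | true => rw [hm] at h; exact absurd h (by simp)
        | false =>
          rw [hm] at h
          simp only [cond_false] at h
          rcases List.mem_cons.1 hq' with rfl | hq'
          · intro hdvd
            have h0 : Nat.mod n q' = 0 := Nat.mod_eq_zero_of_dvd hdvd
            have : Nat.beq (Nat.mod n q') 0 = true := by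
              rw [h0]
              rfl
            rw [this] at hm
            exact Bool.noConfusion hm
          · exact hasFactor_false_sound t n hs.2 h q' hq' hqq

/-- The least factor of an odd composite `n ≥ 2` is an odd prime `m` with `m² ≤ n`. [folklore] -/
theorem minFac_odd_of_odd {n : ℕ} (hodd : Odd n) (h2 : 2 ≤ n) :
    (Nat.minFac n).Prime ∧ Odd (Nat.minFac n) ∧ Nat.minFac n ∣ n := by
  have hn1 : n ≠ 1 := by omega
  refine ⟨Nat.minFac_prime hn1, ?_, Nat.minFac_dvd n⟩
  exact hodd.of_dvd_nat (Nat.minFac_dvd n)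

/-- **Soundness of `primeChk`**: an odd `n < 2153² = 4635409` accepted by `primeChk` is prime.
[folklore] -/
theorem primeChk_sound {n : ℕ} (h : primeChk n = true) (hodd : Odd n) (hn : n < 4635409) :
    n.Prime := by
  obtain ⟨hsorted, hmem3, hcomplete⟩ := smallOddPrimes_spec
  simp only [primeChk] at h
  by_contra hnp
  cases hle : Nat.ble n 2143 with
  | true =>
    rw [hle] at h
    simp only [cond_true, Bool.and_eq_true, Bool.not_eq_true'] at h
    obtain ⟨h1, hf⟩ := h
    have hle' : n ≤ 2143 := by simpa [Nat.ble_eq] using hle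
    have h1' : 1 < n := by simpa [Nat.blt_eq] using h1
    obtain ⟨hmp, hmodd, hmdvd⟩ := minFac_odd_of_odd hodd h1'
    have hsq : Nat.minFac n ^ 2 ≤ n := Nat.minFac_sq_le_self (by omega) hnp
    have hmle : Nat.minFac n ≤ 2143 := by
      have := Nat.minFac_le (show 0 < n by omega)
      omega
    have hmmem := hcomplete _ hmp hmodd hmle
    exact hasFactor_false_sound smallOddPrimes n hsorted hf _ hmmem (by rw [sq] at hsq; exact hsq)
      hmdvd
  | false =>
    rw [hle] at h
    simp only [cond_false] at h
    have hgt : ¬ n ≤ 2143 := by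
      intro hh
      have : Nat.ble n 2143 = true := by simpa [Nat.ble_eq] using hh
      rw [this] at hle
      exact Bool.noConfusion hle
    have hg : Nat.gcd n sieveModulus = 1 := Nat.eq_of_beq_eq_true h
    obtain ⟨hmp, hmodd, hmdvd⟩ := minFac_odd_of_odd hodd (by omega)
    have hsq : Nat.minFac n ^ 2 ≤ n := Nat.minFac_sq_le_self (by omega) hnp
    have hmlt : Nat.minFac n < 2153 := by
      by_contra hh
      push Not at hh
      have := Nat.mul_le_mul hh hh
      rw [sq] at hsq
      omega
    by_cases hm : Nat.minFac n ≤ 2143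
    · -- an odd prime `≤ 2143` divides `sieveModulus`, hence `gcd(n, M)`, which is `1`
      have hmmem := hcomplete _ hmp hmodd hm
      have hdvdM : Nat.minFac n ∣ sieveModulus := by
        rw [sieveModulus_eq]
        exact List.dvd_prod hmmem
      have : Nat.minFac n ∣ 1 := hg ▸ Nat.dvd_gcd hmdvd hdvdM
      exact hmp.one_lt.ne' (Nat.dvd_one.1 this)
    · -- there is no prime in `(2143, 2153)`
      push Not at hm
      generalize hq : Nat.minFac n = q at hmp hm hmlt
      interval_cases q <;> exact absurd hmp (by norm_num)

/-! ### The logarithm of the next prime -/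

/-- **Soundness of `logNext`**: from `Llo ≤ 2⁸⁰ log p ≤ Lhi` (`0 < p ≤ p'`) to
`Llo' ≤ 2⁸⁰ log p' ≤ Lhi'`. [folklore] -/
theorem logNext_sound {p Llo Lhi p' Llo' Lhi' : ℕ} (h : logNext p Llo Lhi p' = some (Llo', Lhi'))
    (hp : 0 < p) (hpp : p ≤ p') (hlo : (Llo : ℝ) ≤ 2 ^ 80 * Real.log p)
    (hhi : 2 ^ 80 * Real.log p ≤ Lhi) :
    (Llo' : ℝ) ≤ 2 ^ 80 * Real.log p' ∧ 2 ^ 80 * Real.log p' ≤ Lhi' := by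
  simp only [logNext, Nat.sub_eq, Nat.mul_eq, Nat.add_eq] at h
  cases hb : Nat.ble (2 * (p' - p)) p with
  | false =>
    rw [hb] at h
    simp only [cond_false] at h
    obtain ⟨h1, h2, -⟩ := logN_sound h
    exact ⟨h1, h2⟩
  | true =>
    rw [hb] at h
    simp only [cond_true, Option.some.injEq, Prod.mk.injEq] at h
    obtain ⟨rfl, rfl⟩ := h
    have hg : 2 * (p' - p) ≤ p := by simpa [Nat.ble_eq] using hb
    obtain ⟨h1, h2⟩ := lnp_sound (p := p' - p) hp hg
    have hpR : (0 : ℝ) < p := by exact_mod_cast hp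
    have hlog : Real.log p' = Real.log p + Real.log (1 + ((p' - p : ℕ) : ℝ) / p) := by
      rw [← Real.log_mul hpR.ne' (by positivity)]
      congr 1
      rw [Nat.cast_sub hpp]
      field_simp
      ring
    rw [hlog]
    push_cast
    constructor <;> linarith

end Sound

end Literature.NumberTheory.LFunctions.ThetaChain
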